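import Summits.QuantumFields.YangMills.Theorems.ParabolicTrajectoryTunedSequenceExistsUnitsCore
import Summits.QuantumFields.YangMills.Theorems.LangevinControlUVOSLegsFromFemtoAndGapStubLowerTwoPointMain

/-!
# Crux `TunedSequenceExists` (stmt-QuantumFields-10524) × crux `OSLegsAtWeakCouplingC` (stmt-QuantumFields-16207):
# ONE shared units-form lower bound (X_disp) feeds BOTH — our core (hence (S) with the mirror children)
# AND the sibling's non-triviality two-point leg `DlrCollarTransfer.LowerBounds.1` (lead c7, 2026-08-17)

`UnitsCore` (p157021) typed the core of our crux in continuous intrinsic units at the SHARP temporal lag: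
(X) `SharpLowerBound r A`.  The sibling route `LangevinControlUV` carries the same infinite-volume wall inside
its crux `OSLegsAtWeakCouplingC` as the non-triviality input `LowerBounds G r a` (file
`…LangevinControlUVOSLegsFromFemtoAndGapDefs`, clause 1: a SMEARED, time-reflected lower bound
`ε ≤ Q2_{β,L}(a β)(θv, v)` on all tori `a(β)·L ≥ Λ₅`, `β ≥ β₅`).  This file types their common parent in the
sibling's own vocabulary (`dens`, `torusE`, `siteToE`, a GIVEN unit map `a`):

  (X_disp) `SharpDisp G r a`: `∃ 0 < s₁ < s₂, ε > 0, β₅, Λ₅` with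
  `ε ≤ ‖y − x‖⁸ · Cov_{β,2L+1}(dens x, dens y)` for ALL pairs of sites at physical distance
  `‖y − x‖·a(β) ∈ [s₁, s₂]`, on every torus `a(β)·L ≥ Λ₅`, at every `β ≥ β₅`

(all displacement DIRECTIONS, a genuine band), and proves, sorry-free:

* `sharpLowerBound_of_sharpDisp`: X_disp at a continuous positive unit map `a → 0` ⇒ X_P
  (`UnitsCore.SharpLowerBound r r.curvature.F`; the pair `(0, D e₀)`, `cov_dens_axis_eq_latticeConnectedCorr`);
* `lowerBounds_twoPoint_of_sharpDisp`: **X_disp ⇒ `(LowerBounds G r a).1`** (a positive-time bump of plateau radius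
  `(s₂ − s₁)/16` at height `(s₁ + s₂)/4`: every weighted pair of the smeared sum sits in the band, per-pair floor from
  X_disp, Riemann mass of the two plateaux — the routine of the sibling's `StubLower.lowerBounds_twoPoint` with X_disp in
  place of the conditional package `FBL ∧ FC2`);
* `SharpDispC` — the shared ITEM body in the format of the sibling route's C-items (for every CONTINUOUS unit map
  carrying the femto two-point package `TwoPoint G r a` of stmt-16204): `∀ G r a, Continuous a → TwoPoint G r a →
  SharpDisp G r a`; and the two consumers on landed names:
  **`tunedSequenceExists_of_femtoC_sharpDispC_mirror : FemtoCurvatureTwoPointC → SharpDispC → MirrorBoundInAll →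
  MirrorBoundOutAll → TunedSequenceExists`** (our crux) and
  **`lowerBoundsTwoPoint_of_sharpDispC`** (the sibling's NT two-point input at every continuous package map).

So ONE route-level child (X_disp,C) would discharge the (U)+(V) half of (S) AND the two-point half of 16207's
non-triviality leg (its three-point half `LowerBounds.2` is untouched).  Obligation pieces of the two cruxes,
deliberately untagged (not published facts).  Refs: Chatterjee arXiv:1803.01950 Problem 5.1; Osterwalder–Seiler
1978 §2; Glimm–Jaffe 1987 §6.1 (smeared fields).
-/

set_option autoImplicit false

noncomputable section

open scoped SchwartzMap
open MeasureTheory Filter Topology Metric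
open Literature.MathematicalPhysics.QuantumFieldTheory Literature.MathematicalPhysics.QuantumLattice
open Literature.MathematicalPhysics.AQFT
open Literature.Probability.LatticeModels hiding configShift configShift_apply
open Summit.QuantumFields.YangMills.Theorems.OSLegsFromFemtoAndGap.StubLower
open Summit.QuantumFields.YangMills.Cruxes.OSLegsFromFemtoAndGap.DlrCollarTransfer
open Summit.QuantumFields.YangMills.Cruxes.OSLegsFromFemtoAndGap.DlrCollarTransfer.StubLower

namespace Summit.QuantumFields.YangMills.Theorems.TunedSequenceExists.UnitsShared

/-! ## §1 The shared statement (X_disp) at a given unit map, and the shared item body (X_disp,C) -/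

section Defs

variable (G : Type) [Group G] [TopologicalSpace G] [IsTopologicalGroup G] [CompactSpace G]
  [MeasurableSpace G] [BorelSpace G] (r : LatticeRep G) (a : ℝ → ℝ)

/-- **(X_disp) Sharp infinite-volume lower bound in the units `a`, all displacement directions.**  There are a
physical band `0 < s₁ < s₂`, a height `ε > 0` and floors `β₅, Λ₅` such that on every torus of side `2L+1` with
`a(β)·L ≥ Λ₅`, at every `β ≥ β₅`, for EVERY pair of sites `x, y` of `ℤ⁴` at physical distance
`‖y − x‖·a(β) ∈ [s₁, s₂]`:  `ε ≤ ‖y − x‖⁸ · Cov_{β,2L+1}(dens x, dens y)` (`dens x` = the action density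
translated to `x`, `torusE` = Wilson torus expectation of the periodic lift).  Obligation piece; not a published fact. -/
def SharpDisp : Prop :=
  ∃ (s₁ s₂ ε β₅ Λ₅ : ℝ), 0 < s₁ ∧ s₁ < s₂ ∧ 0 < ε ∧
    ∀ β : ℝ, β₅ ≤ β → ∀ L : ℕ, Λ₅ ≤ a β * L → ∀ x y : Fin 4 → ℤ,
      s₁ ≤ ‖siteToE (y - x)‖ * a β → ‖siteToE (y - x)‖ * a β ≤ s₂ →
        ε ≤ ‖siteToE (y - x)‖ ^ 8 *
          (torusE G r β L (fun U => dens G r x U * dens G r y U) -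
            torusE G r β L (dens G r x) * torusE G r β L (dens G r y))

end Defs

/-- **(X_disp,C) — the shared route-level item body**, in the format of the sibling route's C-items: for every
compact simple `G`, faithful unitary `r` and every CONTINUOUS unit map `a` carrying the femto two-point package
(`TwoPoint G r a`, the body of stmt-QuantumFields-16204 at `a`), the sharp all-direction lower bound holds in the
units `a`. -/
def SharpDispC : Prop :=
  ∀ (G : Type) [Group G] [TopologicalSpace G] [IsTopologicalGroup G] [CompactSpace G],
    IsCompactSimpleLieGroup G → letI : MeasurableSpace G := borel G
    haveI : BorelSpace G := ⟨rfl⟩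
    ∀ (r : LatticeRep G) (a : ℝ → ℝ), Continuous a → TwoPoint G r a → SharpDisp G r a

/-! ## §2 Consumer 1: our crux — X_disp ⇒ X_P ⇒ (with the mirror children) `TunedSequenceExists` -/

section Ours

variable {G : Type} [Group G] [TopologicalSpace G] [IsTopologicalGroup G] [CompactSpace G]
  [MeasurableSpace G] [BorelSpace G]

/-- The embedded axis vector `D e₀` has norm `D`. [folklore] -/
theorem norm_siteToE_axis (D : ℕ) :
    ‖siteToE ((Pi.single 0 (D : ℤ) : Fin 4 → ℤ) - 0)‖ = D := by
  have h1 : (siteToE ((Pi.single 0 (D : ℤ) : Fin 4 → ℤ) - 0) : EuclideanSpace ℝ (Fin 4)) =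
      EuclideanSpace.single 0 (D : ℝ) := by
    ext j
    by_cases hj : j = 0
    · subst hj; simp [siteToE_apply]
    · simp [siteToE_apply, hj]
  rw [h1, PiLp.norm_single, Real.norm_eq_abs, abs_of_nonneg (Nat.cast_nonneg _)]

/-- **The axis pair of the shared statement IS the crux's temporal correlator**:
`Cov_{β,2L+1}(dens 0, dens (D e₀)) = latticeConnectedCorr r.ρ β (2L+1) P P D` (`dens 0 = P`, `dens (D e₀) = P ∘ τ_{−D e₀}`,
and the shifted mean equals the unshifted one by translation invariance of the torus measure). [folklore] -/
theorem cov_dens_axis_eq_latticeConnectedCorr (r : LatticeRep G) (β : ℝ) (L D : ℕ) :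
    torusE G r β L (fun U => dens G r 0 U * dens G r (Pi.single 0 (D : ℤ)) U) -
        torusE G r β L (dens G r 0) * torusE G r β L (dens G r (Pi.single 0 (D : ℤ))) =
      latticeConnectedCorr r.ρ β (2 * L + 1) r.curvature.F r.curvature.F D := by
  have h0 : ∀ V : LGConfig 4 G, configShift (-(0 : Fin 4 → ℤ)) V = V := fun V => by
    funext e; simp [configShift_apply]
  unfold torusE dens latticeConnectedCorr
  have hshift : ∫ U, r.curvature.F (configShift (-(Pi.single 0 (D : ℤ) : Fin 4 → ℤ)) (torusLift (2 * L + 1) U))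
        ∂(wilsonMeasure (d := 4) (L := 2 * L + 1) r.ρ β) =
      ∫ U, r.curvature.F (torusLift (2 * L + 1) U) ∂(wilsonMeasure (d := 4) (L := 2 * L + 1) r.ρ β) :=
    integral_comp_configShift_torusLift r.ρ β r.curvature.F _
  simp only [h0, hshift]

/-- **X_disp ⇒ X_P.**  At a continuous positive unit map `a → 0`, the all-direction shared statement implies the
units-form core of our crux for the corner action density (pairs `(0, D e₀)`). -/
theorem sharpLowerBound_of_sharpDisp (r : LatticeRep G) {a : ℝ → ℝ} (ha : Continuous a)
    (hapos : ∀ β, 0 < a β) (hlim : Tendsto a atTop (𝓝 0)) (h : SharpDisp G r a) :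
    UnitsCore.SharpLowerBound r r.curvature.F := by
  obtain ⟨s₁, s₂, ε, β₅, Λ₅, hs₁, hs₁₂, hε, h⟩ := h
  refine ⟨a, ha, hapos, hlim, s₁, s₂, ε, β₅, Λ₅, hs₁, hs₁₂.le, hε, fun β hβ L D hΛ hD₁ hD₂ => ?_⟩
  have key := h β hβ L hΛ 0 (Pi.single 0 (D : ℤ))
  rw [norm_siteToE_axis, cov_dens_axis_eq_latticeConnectedCorr] at key
  exact key hD₁ hD₂

/-- (X_disp,C) with the sibling crux `FemtoCurvatureTwoPointC` (which supplies the continuous package map) gives X_P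
under the crux prefix. -/
theorem sharpLowerBoundAll_of_femtoC_of_sharpDispC
    (hF : Summit.QuantumFields.YangMills.Theses.LangevinControlUV.FemtoCurvatureTwoPointC)
    (hX : SharpDispC) : UnitsCore.SharpLowerBoundAll := by
  intro G _ _ _ _ hG
  letI : MeasurableSpace G := borel G
  haveI : BorelSpace G := ⟨rfl⟩
  intro r
  obtain ⟨a, ha, hpkg⟩ := hF G hG r
  have hTP : TwoPoint G r a := hpkg
  obtain ⟨Γ, β₀, ℓ₀, c, C, -, -, hapos, hlim, -⟩ := hpkg
  exact sharpLowerBound_of_sharpDisp r ha hapos hlim (hX G hG r a ha hTP)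

end Ours

/-- **Consumer 1, assembled: `FemtoCurvatureTwoPointC → SharpDispC → MirrorBoundInAll → MirrorBoundOutAll →
Summit.QuantumFields.YangMills.Theses.ParabolicTrajectory.TunedSequenceExists`** (sorry-free; the shared child + the
sibling tier-deciding crux replace (U)+(V); the mirror children supply clause (iii)). [cite: OsterwalderSeiler1978, §2] -/
theorem tunedSequenceExists_of_femtoC_sharpDispC_mirror
    (hF : Summit.QuantumFields.YangMills.Theses.LangevinControlUV.FemtoCurvatureTwoPointC) (hX : SharpDispC)
    (hIn : FixedAspectSplit.MirrorBoundInAll) (hOut : FixedAspectSplit.MirrorBoundOutAll) :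
    Summit.QuantumFields.YangMills.Theses.ParabolicTrajectory.TunedSequenceExists :=
  UnitsCore.tunedSequenceExists_of_sharp_mirror_subs (sharpLowerBoundAll_of_femtoC_of_sharpDispC hF hX) hIn hOut

/-! ## §3 Consumer 2: the sibling crux — X_disp ⇒ the two-point half of `LowerBounds G r a` -/

section Theirs

variable (G : Type) [Group G] [TopologicalSpace G] [IsTopologicalGroup G] [CompactSpace G]
  [MeasurableSpace G] [BorelSpace G] (r : LatticeRep G) (a : ℝ → ℝ)

/-- Band bookkeeping: if `‖u + c‖ < 2ρ`, `‖w − c‖ < 2ρ` and `‖c‖ = t` then `2t − 4ρ < ‖w − u‖ < 2t + 4ρ`. [folklore] -/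
theorem norm_sub_mem_band {E : Type*} [NormedAddCommGroup E] {u w c : E} {ρ t : ℝ}
    (hu : ‖u + c‖ < 2 * ρ) (hw : ‖w - c‖ < 2 * ρ) (hc : ‖c + c‖ = 2 * t) :
    2 * t - 4 * ρ < ‖w - u‖ ∧ ‖w - u‖ < 2 * t + 4 * ρ := by
  have hdecomp : w - u = (w - c) - (u + c) + (c + c) := by abel
  have h1 : ‖w - u‖ ≤ ‖(w - c) - (u + c)‖ + ‖c + c‖ := by rw [hdecomp]; exact norm_add_le _ _
  have h2 : ‖(w - c) - (u + c)‖ ≤ ‖w - c‖ + ‖u + c‖ := norm_sub_le _ _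
  have h3 : ‖c + c‖ ≤ ‖w - u‖ + ‖(w - c) - (u + c)‖ := by
    have : c + c = (w - u) - ((w - c) - (u + c)) := by abel
    rw [this]; exact norm_sub_le _ _
  constructor <;> linarith

/-- **X_disp ⇒ the two-point half of `LowerBounds`.**  A positive-time bump `v ≥ 0` at height `(s₁+s₂)/4` with plateau
radius `ρ = (s₂−s₁)/16` (support radius `2ρ`): every pair weighted by `θv ⊗ v` in `Q2` has physical separation in
`(2t − 4ρ, 2t + 4ρ) ⊆ [s₁, s₂]`, so X_disp gives the per-pair floor `ε a⁸/(2t+4ρ)⁸`, and the Riemann mass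
`(ρ/2a)⁴` of each plateau (`pow_le_sum_box`) makes `Q2 ≥ ε (ρ/(4t+8ρ))⁸`, uniformly in `a`. -/
theorem lowerBounds_twoPoint_of_sharpDisp (hapos : ∀ β, 0 < a β) (hlim : Tendsto a atTop (𝓝 0))
    (h : SharpDisp G r a) :
    ∃ (v : 𝓢(EuclideanSpace ℝ (Fin 4), ℝ)) (ε β₅ Λ₅ : ℝ),
      tsupport v ⊆ {y : EuclideanSpace ℝ (Fin 4) | 0 < y 0} ∧ 0 < ε ∧
      ∀ β : ℝ, β₅ ≤ β → ∀ L : ℕ, Λ₅ ≤ a β * L → ε ≤ Q2 G r β L (a β) (thetaTest 4 v) v := by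
  obtain ⟨s₁, s₂, ε, β₅, Λ₅, hs₁, hs₁₂, hε, hX⟩ := h
  -- height `t`, plateau radius `ρ`
  obtain ⟨t, ht⟩ : ∃ t : ℝ, t = (s₁ + s₂) / 4 := ⟨_, rfl⟩
  obtain ⟨ρ, hρ⟩ : ∃ ρ : ℝ, ρ = (s₂ - s₁) / 16 := ⟨_, rfl⟩
  have ht0 : 0 < t := by rw [ht]; linarith
  have hρ0 : 0 < ρ := by rw [hρ]; linarith
  have hband₁ : s₁ ≤ 2 * t - 4 * ρ := by rw [ht, hρ]; linarith
  have hband₂ : 2 * t + 4 * ρ ≤ s₂ := by rw [ht, hρ]; linarith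
  have htρ : 2 * ρ < t := by rw [ht, hρ]; linarith
  -- the bump
  obtain ⟨v, hv0, -, hvone, hvsupp, hvts⟩ :=
    exists_bump_schwartz (EuclideanSpace.single 0 t) (ρ := ρ) hρ0
  -- small spacings: `2 a ≤ ρ`
  obtain ⟨β₀, hβ₀⟩ := exists_of_tendsto_atTop_nhds_zero hlim (a₀ := ρ / 2) (by positivity)
  refine ⟨v, ε * (ρ / (4 * t + 8 * ρ)) ^ 8, max β₀ β₅, max Λ₅ (t + ρ), ?_, by positivity, ?_⟩
  · -- positive time
    rw [hvts]
    intro y hy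
    rw [mem_closedBall, dist_eq_norm] at hy
    have h1 := abs_apply_le_norm (y - EuclideanSpace.single 0 t) 0
    have h2 : |y 0 - t| ≤ 2 * ρ := by simpa using h1.trans hy
    show 0 < y 0
    have := (abs_le.1 h2).1
    linarith
  intro β hβ L hL
  have hββ₀ : β₀ ≤ β := le_of_max_le_left hβ
  have hββ₅ : β₅ ≤ β := le_of_max_le_right hβ
  have hΛL : Λ₅ ≤ a β * L := le_of_max_le_left hL
  have htL : t + ρ ≤ a β * L := le_of_max_le_right hL
  have hα := hapos β
  have hαρ : 2 * a β ≤ ρ := by have := hβ₀ β hββ₀; linarith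
  have hc2 : ‖(EuclideanSpace.single (0 : Fin 4) t : EuclideanSpace ℝ (Fin 4)) +
      EuclideanSpace.single 0 t‖ = 2 * t := by
    rw [← two_smul ℝ (EuclideanSpace.single (0 : Fin 4) t), norm_smul, PiLp.norm_single,
      Real.norm_eq_abs, Real.norm_eq_abs, abs_of_pos ht0, abs_of_pos two_pos]
  -- the per-pair floor
  have key : ∀ x y : Fin 4 → ℤ, thetaTest 4 v (a β • siteToE x) ≠ 0 → v (a β • siteToE y) ≠ 0 →
      ε * a β ^ 8 / (2 * t + 4 * ρ) ^ 8 ≤ torusE G r β L (fun U => dens G r x U * dens G r y U)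
        - torusE G r β L (dens G r x) * torusE G r β L (dens G r y) := by
    intro x y hx hy
    rw [thetaTest_apply] at hx
    have hx' := hvsupp _ hx
    rw [dist_eq_norm, norm_timeReflection_sub_single] at hx'
    have hy' := hvsupp _ hy
    rw [dist_eq_norm] at hy'
    obtain ⟨hlo, hhi⟩ := norm_sub_mem_band hx' hy' hc2
    have hsmul : a β • siteToE y - a β • siteToE x = a β • siteToE (y - x) := by
      rw [siteToE_sub, smul_sub]
    rw [hsmul, norm_smul, Real.norm_eq_abs, abs_of_pos hα, mul_comm] at hlo hhi
    -- physical separation in the band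
    have hsep₁ : s₁ ≤ ‖siteToE (y - x)‖ * a β := by linarith
    have hsep₂ : ‖siteToE (y - x)‖ * a β ≤ s₂ := by linarith
    have hfloor := hX β hββ₅ L hΛL x y hsep₁ hsep₂
    have hnpos : 0 < ‖siteToE (y - x)‖ := by
      by_contra hn
      have : ‖siteToE (y - x)‖ * a β ≤ 0 := mul_nonpos_of_nonpos_of_nonneg (not_lt.1 hn) hα.le
      linarith
    -- `ε / ‖y-x‖⁸ ≥ ε a⁸ / (2t+4ρ)⁸` since `‖y-x‖ a ≤ 2t + 4ρ`
    have hn8 : ‖siteToE (y - x)‖ ^ 8 * a β ^ 8 ≤ (2 * t + 4 * ρ) ^ 8 := by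
      rw [← mul_pow]
      exact pow_le_pow_left₀ (by positivity) hhi.le 8
    rw [div_le_iff₀ (by positivity)]
    calc ε * a β ^ 8 = ε * a β ^ 8 := rfl
      _ ≤ (‖siteToE (y - x)‖ ^ 8 * (torusE G r β L (fun U => dens G r x U * dens G r y U)
            - torusE G r β L (dens G r x) * torusE G r β L (dens G r y))) * a β ^ 8 :=
          mul_le_mul_of_nonneg_right hfloor (by positivity)
      _ = (torusE G r β L (fun U => dens G r x U * dens G r y U)
            - torusE G r β L (dens G r x) * torusE G r β L (dens G r y)) *
            (‖siteToE (y - x)‖ ^ 8 * a β ^ 8) := by ring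
      _ ≤ (torusE G r β L (fun U => dens G r x U * dens G r y U)
            - torusE G r β L (dens G r x) * torusE G r β L (dens G r y)) * (2 * t + 4 * ρ) ^ 8 := by
          refine mul_le_mul_of_nonneg_left hn8 ?_
          -- the covariance is positive: `ε ≤ ‖y-x‖⁸ · cov` with `ε > 0`
          by_contra hneg
          have : ‖siteToE (y - x)‖ ^ 8 * (torusE G r β L (fun U => dens G r x U * dens G r y U)
            - torusE G r β L (dens G r x) * torusE G r β L (dens G r y)) ≤ 0 :=
            mul_nonpos_of_nonneg_of_nonpos (by positivity) (not_le.1 hneg).le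
          linarith
  -- Riemann mass of the two plateaux
  have hcover : ∀ j, |(EuclideanSpace.single (0 : Fin 4) t : EuclideanSpace ℝ (Fin 4)) j| + ρ ≤ a β * L :=
    fun j => by
    have : |(EuclideanSpace.single (0 : Fin 4) t : EuclideanSpace ℝ (Fin 4)) j| ≤ t := by
      rw [PiLp.single_apply]
      split_ifs
      · rw [abs_of_pos ht0]
      · rw [abs_zero]; exact ht0.le
    linarith
  have hSy : (ρ / (2 * a β)) ^ 4 ≤ ∑ y ∈ box 4 L, v (a β • siteToE y) :=
    pow_le_sum_box hv0 hα (fun z hz => hvone z hz) hαρ hcover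
  have hSx : (ρ / (2 * a β)) ^ 4 ≤ ∑ x ∈ box 4 L, thetaTest 4 v (a β • siteToE x) := by
    refine pow_le_sum_box (p := -EuclideanSpace.single 0 t) (fun z => ?_) hα
      (fun z hz => ?_) hαρ (fun j => by simpa using hcover j)
    · rw [thetaTest_apply]; exact hv0 _
    · rw [thetaTest_apply]
      refine hvone _ ?_
      rwa [dist_eq_norm, norm_timeReflection_sub_single, ← sub_neg_eq_add, ← dist_eq_norm]
  -- summation
  have hsum := mul_sum_mul_sum_le (B := box 4 L) (κ := ε * a β ^ 8 / (2 * t + 4 * ρ) ^ 8)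
    (f := fun x => thetaTest 4 v (a β • siteToE x)) (g := fun y => v (a β • siteToE y))
    (C := fun x y => torusE G r β L (fun U => dens G r x U * dens G r y U)
      - torusE G r β L (dens G r x) * torusE G r β L (dens G r y))
    (fun x => by rw [thetaTest_apply]; exact hv0 _) (fun y => hv0 _) key
  unfold Q2
  refine le_trans ?_ hsum
  have hα0 : a β ≠ 0 := hα.ne'
  have h2t : (2 * t + 4 * ρ) ≠ 0 := by positivity
  calc ε * (ρ / (4 * t + 8 * ρ)) ^ 8
      = ε * a β ^ 8 / (2 * t + 4 * ρ) ^ 8 * ((ρ / (2 * a β)) ^ 4 * (ρ / (2 * a β)) ^ 4) := by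
        have h4 : (4 * t + 8 * ρ) = 2 * (2 * t + 4 * ρ) := by ring
        rw [h4]
        field_simp
    _ ≤ _ := mul_le_mul_of_nonneg_left (mul_le_mul hSx hSy (by positivity)
        ((by positivity : (0 : ℝ) ≤ (ρ / (2 * a β)) ^ 4).trans hSx)) (by positivity)

/-- **Consumer 2, assembled**: at every continuous unit map carrying the femto two-point package, the shared child
gives the two-point half of the sibling's non-triviality leg `LowerBounds G r a` (the input of
`OSLegsAtWeakCouplingC`'s assembly; its three-point half is untouched). -/
theorem lowerBoundsTwoPoint_of_sharpDispC (hX : SharpDispC) :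
    ∀ (G : Type) [Group G] [TopologicalSpace G] [IsTopologicalGroup G] [CompactSpace G],
      IsCompactSimpleLieGroup G → letI : MeasurableSpace G := borel G
      haveI : BorelSpace G := ⟨rfl⟩
      ∀ (r : LatticeRep G) (a : ℝ → ℝ), Continuous a → TwoPoint G r a →
        ∃ (v : 𝓢(EuclideanSpace ℝ (Fin 4), ℝ)) (ε β₅ Λ₅ : ℝ),
          tsupport v ⊆ {y : EuclideanSpace ℝ (Fin 4) | 0 < y 0} ∧ 0 < ε ∧
          ∀ β : ℝ, β₅ ≤ β → ∀ L : ℕ, Λ₅ ≤ a β * L → ε ≤ Q2 G r β L (a β) (thetaTest 4 v) v := by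
  intro G _ _ _ _ hG
  letI : MeasurableSpace G := borel G
  haveI : BorelSpace G := ⟨rfl⟩
  intro r a ha hTP
  have hX' := hX G hG r a ha hTP
  obtain ⟨Γ, β₀, ℓ₀, c, C, -, -, hapos, hlim, -⟩ := hTP
  exact lowerBounds_twoPoint_of_sharpDisp G r a hapos hlim hX'

end Theirs

end Summit.QuantumFields.YangMills.Theorems.TunedSequenceExists.UnitsShared

end
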